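import Literature.AlgebraicGeometry.Modules.DerivedPushforward
import Literature.AlgebraicGeometry.Modules.PushforwardAcyclicResolution
import Literature.Algebra.Homology.ExtBiproduct
import Mathlib.Algebra.Homology.Embedding.CochainComplex
import Mathlib.Algebra.Homology.Embedding.ExtendHomology
import HarnessLib

/-!
# `Rf_*` is computed by `f_*`-acyclic resolutions: `Rf_*(N) ≅ f_*(K•)` for a resolution
# `N → K⁰ → K¹ → ⋯` by `f_*`-acyclic modules (Hartshorne III Prop. 1.2A / III.8; Stacks 05TA),
# and the single-object bookkeeping `D⁺(G)(N[0]) ≅ (G N)[0]` for exact `G`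

Layer `Literature/AlgebraicGeometry/Modules`. For a morphism of schemes `f : X ⟶ Y`, an `𝒪_X`-module
`N` and a quasi-isomorphism `ι : N[0] ⟶ K•` into an `ℕ`-indexed cochain complex of `f_*`-ACYCLIC modules
(`IsPushforwardAcyclic f (Kⁿ)`, `Modules/PushforwardAcyclicResolution`: `Hⁱ(f⁻¹V, Kⁿ) = 0` for `V` affine,
`i > 0` — e.g. Čech sheaves of a quasi-coherent module, flasque modules, injective modules), the derived
direct image of `Modules/DerivedPushforward` is computed by `K•`:

  **`Rf_*(N[0]) ≅ Q(f_*K•)`** in `D⁺(Mod 𝒪_Y)` (`nonempty_derivedPushforwardPlus_single_iso_of_isPushforwardAcyclic`),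

`K•` read as a bounded-below `ℤ`-complex (`plusOfNat K` = Mathlib's extension by zero along
`ComplexShape.embeddingUpNat`). Proof: choose an injective resolution `K• ⥲ I•` (Mathlib CM5a,
`DerivedPushforward.exists_injective_resolution`); `N[0] ⥲ K• ⥲ I•` is an injective resolution of `N`, so
`Rf_*(N[0]) ≅ Q(f_*I•)` (`derivedPushforwardPlusObjIso`), and `f_*K• ⟶ f_*I•` is a quasi-isomorphism by
Leray's acyclicity lemma (`quasiIso_pushforward_map_of_isPushforwardAcyclic`: both complexes have
`f_*`-acyclic terms). This is Hartshorne III Prop. 1.2A ("acyclic resolutions compute derived functors")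
for `f_*`, read in `D⁺`.

Bookkeeping (§1, pure homological algebra on Mathlib's `DerivedCategory.Plus`; no schemes):
* `singlePlus N : C⁺` — the complex `N[0]` as a bounded-below complex; `plusOfNat K : C⁺` — an
  `ℕ`-complex extended by zero; `plusOfNatι ι : singlePlus N ⟶ plusOfNat K` induced by
  `ι : (single₀ N) ⟶ K`, a quasi-isomorphism when `ι` is (`quasiIso_plusOfNatι_hom`);
* `ιQObjIso K : ι(Q K) ≅ Q(K.obj)` and **`singleFunctorPlusObjIsoQ N : (singleFunctor C 0) N ≅ Q(singlePlus N)`**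
  in `D⁺(C)` (Mathlib's `DerivedCategory.Plus.singleFunctor` versus the localisation functor `Plus.Q`);
* **`mapDerivedCategoryPlusSingleIso G N : D⁺(G)((singleFunctor C 0) N) ≅ (singleFunctor D 0)(G N)`** for an
  exact functor `G` (`RightDerivedFunctorPlusInjectiveModel.mapDerivedCategoryPlusFactors` + Mathlib
  `HomologicalComplex.singleMapHomologicalComplex`).
And (§2) `IsAcyclicOn.of_iso`, `IsPushforwardAcyclic.of_iso`, `IsPushforwardAcyclic.extend_X` (the terms
of `plusOfNat K` are `f_*`-acyclic when those of `K` are).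

Everything PROVED; 0 named facts; no instances. Typed for the cell `pub-hodge-ring2` (brick (K4) «derived
flat base change of one quasi-coherent sheaf», where both sides are computed by Čech resolutions); a research
route conditional on HC_CM, not a corollary — nothing in this file refers to it.

## References

* R. Hartshorne, *Algebraic Geometry*, GTM 52 (1977), III Prop. 1.2A (acyclic resolutions compute derived
  functors), III §8 Prop. 8.1 (higher direct images as derived functors of `f_*`). [Hartshorne1977]
* The Stacks Project, Tag 05TA (Leray's acyclicity lemma), Tag 013K (derived functors via resolutions by
  acyclic objects). [StacksProject]
* C. A. Weibel, *An introduction to homological algebra* (1994), Exact Functors 10.5.2, Existence Thm. 10.5.6,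
  Cor. 10.5.9. [Weibel1994]
-/

noncomputable section

-- `TopCat.Presheaf`/`Scheme.Modules` are not reducible (as in Mathlib's `AlgebraicGeometry/Modules/Sheaf.lean`).
set_option backward.isDefEq.respectTransparency false

open CategoryTheory CategoryTheory.Limits AlgebraicGeometry
open Literature.AlgebraicGeometry.HodgeTheory

universe w w' v v' u u'

namespace Literature.AlgebraicGeometry.Modules

/-! ### §1 Single complexes and `ℕ`-complexes as objects of `C⁺`; their images in `D⁺` -/

section Plus

variable {C : Type u} [Category.{v} C] [Abelian C]

/-- **`N[0]` as a bounded-below cochain complex** (`(singleFunctor C 0) N` with its bound `0`).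
[cite: Weibel1994, Exact Functors 10.5.2 (notation `A[0]`)] -/
def singlePlus (N : C) : CochainComplex.Plus C :=
  ⟨(CochainComplex.singleFunctor C 0).obj N, 0, inferInstance⟩

/-- The underlying complex of `singlePlus N` is `(singleFunctor C 0) N` (definitional).
[cite: Weibel1994, Exact Functors 10.5.2] -/
theorem singlePlus_obj (N : C) : (singlePlus N).obj = (CochainComplex.singleFunctor C 0).obj N := rfl

/-- **An `ℕ`-indexed cochain complex as a bounded-below `ℤ`-complex** (extension by zero in negative
degrees, Mathlib `HomologicalComplex.extend` along `ComplexShape.embeddingUpNat`).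
[cite: Hartshorne1977, III §1 p. 204 (complexes `K•` in degrees `≥ 0`)] -/
def plusOfNat (K : CochainComplex C ℕ) : CochainComplex.Plus C :=
  ⟨K.extend ComplexShape.embeddingUpNat, 0, inferInstance⟩

/-- The underlying complex of `plusOfNat K` (definitional). [cite: Hartshorne1977, III §1 p. 204] -/
theorem plusOfNat_obj (K : CochainComplex C ℕ) : (plusOfNat K).obj = K.extend ComplexShape.embeddingUpNat := rfl

/-- `plusOfNat K` is concentrated in degrees `≥ 0`. [cite: Hartshorne1977, III §1 p. 204] -/
theorem isStrictlyGE_plusOfNat (K : CochainComplex C ℕ) : CochainComplex.IsStrictlyGE (plusOfNat K).obj 0 :=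
  inferInstanceAs (CochainComplex.IsStrictlyGE (K.extend ComplexShape.embeddingUpNat) 0)

/-- `singlePlus N` is concentrated in degrees `≥ 0`. [cite: Weibel1994, Exact Functors 10.5.2] -/
theorem isStrictlyGE_singlePlus (N : C) : CochainComplex.IsStrictlyGE (singlePlus N).obj 0 :=
  inferInstanceAs (CochainComplex.IsStrictlyGE ((CochainComplex.singleFunctor C 0).obj N) 0)

/-- **The morphism `N[0] ⟶ K•` of bounded-below complexes induced by an augmentation
`ι : single₀ N ⟶ K` of an `ℕ`-complex** (Mathlib's `InjectiveResolution.ι'` pattern: transport along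
`extendSingleIso`, then `extendFunctor.map ι`). [cite: Hartshorne1977, III §1 p. 204] -/
def plusOfNatι {N : C} {K : CochainComplex C ℕ} (ι : (CochainComplex.single₀ C).obj N ⟶ K) :
    singlePlus N ⟶ plusOfNat K :=
  ObjectProperty.homMk (show (CochainComplex.singleFunctor C 0).obj N ⟶ K.extend ComplexShape.embeddingUpNat from
    (HomologicalComplex.extendSingleIso _ _ _ _ (by simp)).inv ≫ (ComplexShape.embeddingUpNat.extendFunctor C).map ι)

/-- `plusOfNatι ι` is a quasi-isomorphism when `ι` is. [cite: Hartshorne1977, III §1 p. 204] -/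
theorem quasiIso_plusOfNatι_hom {N : C} {K : CochainComplex C ℕ} (ι : (CochainComplex.single₀ C).obj N ⟶ K)
    [QuasiIso ι] : QuasiIso (plusOfNatι ι).hom := by
  change QuasiIso ((HomologicalComplex.extendSingleIso ComplexShape.embeddingUpNat N (0 : ℕ) (0 : ℤ) _).inv ≫
    HomologicalComplex.extendMap ι ComplexShape.embeddingUpNat)
  infer_instance

variable [HasDerivedCategory.{w} C]

/-- `ι(Q K•) ≅ Q(K•.obj)`: the image in `D(C)` of the class of a bounded-below complex in `D⁺(C)` is the
class of its underlying complex (Mathlib `quotientCompQhIso`). [cite: Weibel1994, Existence Thm. 10.5.6 (`q`)] -/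
def ιQObjIso (K : CochainComplex.Plus C) :
    DerivedCategory.Plus.ι.obj (DerivedCategory.Plus.Q.obj K) ≅ DerivedCategory.Q.obj K.obj :=
  (DerivedCategory.quotientCompQhIso C).app K.obj

/-- **`(singleFunctor C 0) N ≅ Q(N[0])` in `D⁺(C)`**: Mathlib's single functor into `D⁺` is the class of
the single complex (both map to `Q((single 0) N)` under the fully faithful `ι : D⁺ ⥤ D`).
[cite: Weibel1994, Exact Functors 10.5.2] -/
def singleFunctorPlusObjIsoQ (N : C) :
    (DerivedCategory.Plus.singleFunctor C 0).obj N ≅ DerivedCategory.Plus.Q.obj (singlePlus N) :=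
  (DerivedCategory.TStructure.t (C := C)).plus.fullyFaithfulι.preimageIso
    ((DerivedCategory.singleFunctorIsoCompQ C 0).app N ≪≫ (ιQObjIso (singlePlus N)).symm)

variable {D : Type u'} [Category.{v'} D] [Abelian D] [HasDerivedCategory.{w'} D]
  (G : C ⥤ D) [G.Additive] [PreservesFiniteLimits G] [PreservesFiniteColimits G]

/-- `G(N[0]) ≅ (G N)[0]` as bounded-below complexes (Mathlib `singleMapHomologicalComplex`).
[cite: Weibel1994, Exact Functors 10.5.2] -/
def mapCochainComplexPlusSinglePlusIso (N : C) :
    G.mapCochainComplexPlus.obj (singlePlus N) ≅ singlePlus (G.obj N) :=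
  (CochainComplex.Plus.fullyFaithfulι D).preimageIso
    ((HomologicalComplex.singleMapHomologicalComplex G (ComplexShape.up ℤ) 0).app N)

/-- **`D⁺(G)((singleFunctor C 0) N) ≅ (singleFunctor D 0)(G N)` for an exact functor `G`** — an exact
functor is computed termwise, and termwise it sends `N[0]` to `(G N)[0]`.
[cite: Weibel1994, Exact Functors 10.5.2] -/
def mapDerivedCategoryPlusSingleIso (N : C) :
    G.mapDerivedCategoryPlus.obj ((DerivedCategory.Plus.singleFunctor C 0).obj N) ≅
      (DerivedCategory.Plus.singleFunctor D 0).obj (G.obj N) :=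
  G.mapDerivedCategoryPlus.mapIso (singleFunctorPlusObjIsoQ N) ≪≫
    G.mapDerivedCategoryPlusFactors.app (singlePlus N) ≪≫
    DerivedCategory.Plus.Q.mapIso (mapCochainComplexPlusSinglePlusIso G N) ≪≫
    (singleFunctorPlusObjIsoQ (G.obj N)).symm

end Plus

/-! ### §2 Acyclicity is invariant under isomorphism; the terms of `plusOfNat K` -/

section Acyclic

variable {X Y : Scheme.{u}} (f : X ⟶ Y)

/-- Acyclicity on an open is invariant under isomorphism of modules. [cite: Hartshorne1977, III Prop. 1.2A] -/
theorem IsAcyclicOn.of_iso {F G : X.Modules} (e : F ≅ G) {U : X.Opens} (h : IsAcyclicOn F U) :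
    IsAcyclicOn G U := fun n => by
  haveI := h n
  exact Literature.Algebra.Homology.Ext.subsingleton_of_iso ((modulesToSheaf X).mapIso e)

/-- `f_*`-acyclicity is invariant under isomorphism of modules. [cite: Hartshorne1977, III Prop. 1.2A] -/
theorem IsPushforwardAcyclic.of_iso {F G : X.Modules} (e : F ≅ G) (h : IsPushforwardAcyclic f F) :
    IsPushforwardAcyclic f G := fun V hV => IsAcyclicOn.of_iso e (h V hV)

/-- The terms of `plusOfNat K` are `f_*`-acyclic when the terms of `K` are (they are the `Kⁿ` and zero
objects). [cite: Hartshorne1977, III Prop. 1.2A] -/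
theorem IsPushforwardAcyclic.plusOfNat_X {K : CochainComplex X.Modules ℕ}
    (hK : ∀ n, IsPushforwardAcyclic f (K.X n)) (n : ℤ) : IsPushforwardAcyclic f ((plusOfNat K).obj.X n) := by
  by_cases hn : 0 ≤ n
  · obtain ⟨k, rfl⟩ := Int.eq_ofNat_of_zero_le hn
    exact IsPushforwardAcyclic.of_iso f
      (HomologicalComplex.extendXIso K ComplexShape.embeddingUpNat (i := k) rfl).symm (hK k)
  · haveI := isStrictlyGE_plusOfNat K
    exact IsPushforwardAcyclic.of_isZero f (CochainComplex.isZero_of_isStrictlyGE (plusOfNat K).obj 0 n (by lia))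

end Acyclic

/-! ### §3 `Rf_*` of a single module via an `f_*`-acyclic resolution -/

section Resolution

variable {X Y : Scheme.{u}} (f : X ⟶ Y) [HasDerivedCategory.{w} X.Modules] [HasDerivedCategory.{w'} Y.Modules]

/-- **`Rf_*(N[0]) ≅ Q(f_*K•)` for an `f_*`-acyclic resolution `N[0] ⥲ K•`** (Hartshorne III Prop. 1.2A
for the left exact functor `f_*`, read on `D⁺`): `ι : single₀ N ⟶ K` a quasi-isomorphism of `ℕ`-complexes
of `𝒪_X`-modules with every `Kⁿ` `f_*`-acyclic; then the derived direct image of `N` (in degree `0`) is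
the class of the termwise direct image `f_*K•`. [cite: Hartshorne1977, III Prop. 1.2A and III Prop. 8.1]
[cite: StacksProject, Tag 05TA] [cite: Weibel1994, Cor. 10.5.9] -/
theorem nonempty_derivedPushforwardPlus_single_iso_of_isPushforwardAcyclic (N : X.Modules)
    (K : CochainComplex X.Modules ℕ) (ι : (CochainComplex.single₀ X.Modules).obj N ⟶ K) [QuasiIso ι]
    (hK : ∀ n, IsPushforwardAcyclic f (K.X n)) :
    Nonempty ((derivedPushforwardPlus f).obj ((DerivedCategory.Plus.singleFunctor X.Modules 0).obj N) ≅
      DerivedCategory.Plus.Q.obj ((Scheme.Modules.pushforward f).mapCochainComplexPlus.obj (plusOfNat K))) := by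
  haveI := isStrictlyGE_plusOfNat K
  haveI := isStrictlyGE_singlePlus N
  obtain ⟨I, hI0, hI, ιI, hιI⟩ := exists_injective_resolution (plusOfNat K) 0
  haveI := quasiIso_plusOfNatι_hom ι
  haveI : QuasiIso (plusOfNatι ι ≫ ιI).hom := by
    change QuasiIso ((plusOfNatι ι).hom ≫ ιI.hom)
    infer_instance
  -- Leray: `f_*K• ⟶ f_*I•` is a quasi-isomorphism (both have `f_*`-acyclic terms)
  haveI : QuasiIso ((Scheme.Modules.pushforward f).mapCochainComplexPlus.map ιI).hom :=
    quasiIso_pushforward_map_of_isPushforwardAcyclic f ιI.hom 0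
      (IsPushforwardAcyclic.plusOfNat_X f hK) (fun n => IsPushforwardAcyclic.of_injective f (I.obj.X n))
  haveI := Functor.isIso_Q_map_of_quasiIso (C := Y.Modules) ((Scheme.Modules.pushforward f).mapCochainComplexPlus.map ιI)
  exact ⟨(derivedPushforwardPlus f).mapIso (singleFunctorPlusObjIsoQ N) ≪≫ derivedPushforwardPlusObjIso f (plusOfNatι ι ≫ ιI) ≪≫
    (asIso (DerivedCategory.Plus.Q.map ((Scheme.Modules.pushforward f).mapCochainComplexPlus.map ιI))).symm⟩

end Resolution

end Literature.AlgebraicGeometry.Modules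

end
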